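import Summits.QuantumFields.YangMills.Theorems.FlatTubeReductionOrthoTransverseReflection
import Summits.QuantumFields.YangMills.Theorems.TwistedTraceScaling.Negative.AvgKernelStiffFlip
import HarnessLib

/-!
# The fibre reflection `ι : (u, v) ↦ (u, −v)` of the tube domain is a measure-preserving measurable equivalence commuting with the constant gauge action
# (rate twin of `stub_boRate`, crux K1 `NearFlatRatioLaw` stmt-QuantumFields-24720, line «borate»; the `hι` input of `…KernelParity` on lane A's tube)

`Theorems/FlatTubeReductionOrthoTransverseReflection.lean` (p641784) proved that the transverse measure `π = orthoTransverse L` on `(ℝ³)^E` is even.  The parity lemmas of the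
rate twin (`KernelParity.integral_prod_eq_zero_of_odd`, `….abs_form_sub_le_of_kernel_near_odd`) are applied on the tube DOMAIN `X = SU(2)³ × capBalancedSet L` with
`μ = slowMeasure (orthoChart L) = σ^{⊗3} ⊗ π` (`slowMeasure_eq_prod`) and want `ι : X ≃ᵐ X` with `MeasurePreserving ι μ μ`.  This file lifts evenness to that form:
* ★ `map_neg_slowMarginal` — the transverse marginal on the capped balanced SUBTYPE is even (from `orthoTransverse_map_neg` through the measurable embedding `Subtype.val`,
  `MeasurableEmbedding.comap_map`);
* ★★ `measurePreserving_fibreNeg` — `(u, v) ↦ (u, −v)` preserves `slowMeasure (orthoChart L)` (product structure + `MeasurePreserving.prod`);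
* ★★ `exists_fibreNeg_measurableEquiv` — the same map as a measure-preserving MEASURABLE EQUIVALENCE of the tube domain (the `hι` of `KernelParity`, def-free as an `∃`);
* `slowEmb_fibreNeg` — `ι` does not move the slow variable (one-site factors are `ι`-even); `ι` commutes with the diagonal constant-gauge action
  `(u, v) ↦ (Ad_g u, Ad(g) v)` by linearity, `colourRotate_neg` (the `hcomm` of `KernelTwist.twist_map_map`).
HONEST FRAMING: exact measure bookkeeping on lane A's chart for the rate twin of a registered stub of crux K1 of the CONDITIONAL reduction route `FlatTubeReduction` (R2b1 RECORD-label
femto rung; fixed lattice `(ℤ/L)³`, `β → ∞`); no kernel estimate; `stub_boRate` untouched; not infinite volume, not a mass gap, not Clay.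
-/

set_option autoImplicit false

noncomputable section

open MeasureTheory Filter Topology Real
open scoped BigOperators Matrix
open Literature.MathematicalPhysics.QuantumFieldTheory hiding SU2
open Literature.MathematicalPhysics.QuantumLattice

namespace Summit.QuantumFields.YangMills.Theorems.FemtoTransferGap.TwoLattice.ConstTube

open Summit.QuantumFields.YangMills.Theorems.FemtoTransferGap
open Summit.QuantumFields.YangMills.Theorems.FemtoTransferGap.TwoLattice.SlowChart
open Summit.QuantumFields.YangMills.Theorems.TwistedTraceScaling.Negative.R33 (neg_mem_capBalancedSet)

variable (L : ℕ) [NeZero L]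

/-! ## §1 The transverse marginal on the subtype is even -/

/-- The fibre reflection of the capped balanced subtype is measurable. [folklore] -/
theorem measurable_negCap :
    Measurable fun v : capBalancedSet L => (⟨-(v : Edge 3 L → Fin 3 → ℝ), neg_mem_capBalancedSet v.2⟩ : capBalancedSet L) :=
  (measurable_subtype_coe.neg).subtype_mk

/-- The fibre reflection of the capped balanced subtype is an involution. [folklore] -/
theorem negCap_negCap (v : capBalancedSet L) :
    (⟨-((⟨-(v : Edge 3 L → Fin 3 → ℝ), neg_mem_capBalancedSet v.2⟩ : capBalancedSet L) : Edge 3 L → Fin 3 → ℝ),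
        neg_mem_capBalancedSet (neg_mem_capBalancedSet v.2)⟩ : capBalancedSet L) = v :=
  Subtype.ext (neg_neg _)

/-- ★ **The transverse marginal on the capped balanced subtype is even** (`orthoTransverse_map_neg` pulled back through the measurable embedding `Subtype.val`). [folklore] -/
theorem map_neg_slowMarginal :
    (slowMarginal (orthoChart L)).map (fun v : capBalancedSet L => (⟨-(v : Edge 3 L → Fin 3 → ℝ), neg_mem_capBalancedSet v.2⟩ : capBalancedSet L)) =
      slowMarginal (orthoChart L) := by
  have hNm := measurable_negCap L
  have hemb : MeasurableEmbedding (Subtype.val : capBalancedSet L → Edge 3 L → Fin 3 → ℝ) := MeasurableEmbedding.subtype_coe (measurableSet_capBalancedSet L)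
  have hcomm : (Subtype.val ∘ fun v : capBalancedSet L => (⟨-(v : Edge 3 L → Fin 3 → ℝ), neg_mem_capBalancedSet v.2⟩ : capBalancedSet L)) =
      (fun v : Edge 3 L → Fin 3 → ℝ => -v) ∘ Subtype.val := rfl
  have h1 : ((slowMarginal (orthoChart L)).map (fun v : capBalancedSet L => (⟨-(v : Edge 3 L → Fin 3 → ℝ), neg_mem_capBalancedSet v.2⟩ : capBalancedSet L))).map
      Subtype.val = (slowMarginal (orthoChart L)).map Subtype.val := by
    rw [Measure.map_map measurable_subtype_coe hNm, hcomm, ← Measure.map_map measurable_neg measurable_subtype_coe]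
    exact orthoTransverse_map_neg L
  rw [← hemb.comap_map ((slowMarginal (orthoChart L)).map _), h1, hemb.comap_map]

/-! ## §2 ★★ The fibre reflection of the tube domain preserves the pulled-back measure -/

/-- ★★ **THE FIBRE REFLECTION `(u, v) ↦ (u, −v)` PRESERVES `slowMeasure (orthoChart L) = σ^{⊗3} ⊗ π`.** [folklore] -/
theorem measurePreserving_fibreNeg :
    MeasurePreserving (fun p : GaugeConfig 3 1 SU2 × capBalancedSet L =>
        (p.1, (⟨-(p.2 : Edge 3 L → Fin 3 → ℝ), neg_mem_capBalancedSet p.2.2⟩ : capBalancedSet L)))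
      (slowMeasure (orthoChart L)) (slowMeasure (orthoChart L)) := by
  haveI : PolishSpace (capBalancedSet L) := (isClosed_capBalancedSet L).polishSpace
  haveI := isFiniteMeasure_slowMarginal (continuous_orthoChart L) (orthoChart_injective L)
  have hN : MeasurePreserving (fun v : capBalancedSet L => (⟨-(v : Edge 3 L → Fin 3 → ℝ), neg_mem_capBalancedSet v.2⟩ : capBalancedSet L))
      (slowMarginal (orthoChart L)) (slowMarginal (orthoChart L)) := ⟨measurable_negCap L, map_neg_slowMarginal L⟩
  have h := (MeasurePreserving.id (configMeasure SU2 1)).prod hN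
  rw [slowMeasure_eq_prod (continuous_orthoChart L) (orthoChart_injective L) (orthoChart_mul L)]
  exact h

/-- ★★ **The fibre reflection as a measure-preserving MEASURABLE EQUIVALENCE of the tube domain** — the hypothesis `hι` of `KernelParity.integral_prod_eq_zero_of_odd` /
`KernelParity.abs_form_sub_le_of_kernel_near_odd` on `X = SU(2)³ × capBalancedSet L`, `μ = slowMeasure (orthoChart L)`. [folklore] -/
theorem exists_fibreNeg_measurableEquiv :
    ∃ ι : (GaugeConfig 3 1 SU2 × capBalancedSet L) ≃ᵐ (GaugeConfig 3 1 SU2 × capBalancedSet L),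
      (∀ p, ι p = (p.1, (⟨-(p.2 : Edge 3 L → Fin 3 → ℝ), neg_mem_capBalancedSet p.2.2⟩ : capBalancedSet L))) ∧
        (∀ p, ι.symm p = (p.1, (⟨-(p.2 : Edge 3 L → Fin 3 → ℝ), neg_mem_capBalancedSet p.2.2⟩ : capBalancedSet L))) ∧
          MeasurePreserving ι (slowMeasure (orthoChart L)) (slowMeasure (orthoChart L)) := by
  let N : capBalancedSet L ≃ᵐ capBalancedSet L :=
    { toFun := fun v => ⟨-(v : Edge 3 L → Fin 3 → ℝ), neg_mem_capBalancedSet v.2⟩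
      invFun := fun v => ⟨-(v : Edge 3 L → Fin 3 → ℝ), neg_mem_capBalancedSet v.2⟩
      left_inv := fun v => negCap_negCap L v
      right_inv := fun v => negCap_negCap L v
      measurable_toFun := measurable_negCap L
      measurable_invFun := measurable_negCap L }
  refine ⟨MeasurableEquiv.prodCongr (MeasurableEquiv.refl _) N, fun p => rfl, fun p => rfl, ?_⟩
  exact measurePreserving_fibreNeg L

/-! ## §3 The slow variable is not moved -/

/-- Under the slow embedding the fibre reflection does not move the slow variable: both points lie over the same `u` (one-site factors are `ι`-even). [folklore] -/
theorem slowEmb_fibreNeg (p : GaugeConfig 3 1 SU2 × capBalancedSet L) :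
    slowEmb (orthoChart L) (p.1, (⟨-(p.2 : Edge 3 L → Fin 3 → ℝ), neg_mem_capBalancedSet p.2.2⟩ : capBalancedSet L)) =
      orthoTube L p.1⁻¹ (-(p.2 : Edge 3 L → Fin 3 → ℝ)) := rfl

end Summit.QuantumFields.YangMills.Theorems.FemtoTransferGap.TwoLattice.ConstTube

end
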